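import Mathlib
import HarnessLib
import HarnessLib.Audit
import Summits.CriticalPhenomena.Statement
import Literature.Probability.RandomPlanarGeometry.HexSAW
import Literature.Probability.RandomPlanarGeometry.YangBaxterSAW
import HarnessLib.Audit.Status.Attr

/-!
Route: SAWHexUniversality

CLOSED (retired) 2026-08-15T13:48:09Z by operator:999:1257524 — reason: not-a-thesis: assembly does not conclude the sub-problem Statement — note: D-0027 §2.1 audit (human 2026-08-15: routes that do not decide the summit are removed): the assembly concludes `Literature.Probability.RandomPlanarGeometry.SAW.SAWScalingLimit`, not the sub-problem statement; a NEW conforming route may be opened from the same idea (generated `closes : … → _root_.SAW. The file is kept as the record of this route; refuted decls are indexed as negative knowledge (`ledger negatives`).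

It suffices to show X3 = (H) ∧ (U) [integrable neighbour + universality transfer]:
 (H) HexConjecture: Duminil-Copin–Smirnov 2012 Conjecture 1 as printed — on the HEXAGONAL lattice
δHex, in every Dobrushin
     domain (Ω; a, b), the SAW law P_{x_c,δ} (weight x_c^{ℓ(γ)}, x_c = 1/√(2+√2)) from a_δ to b_δ
converges to chordal SLE_{8/3};
 (U) LatticeUniversality: for every Dobrushin domain and endpoint approximations on both lattices,
the square-lattice
     critical SAW law (Literature.Probability.RandomPlanarGeometry.SAW.law) and the hexagonal one
become asymptotically equal in law on CurveClass ℂ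
     (difference of test integrals → 0 as δ → 0+).
Then SAWScalingLimit follows in one line. (H) is the case where an integrable structure exists (DCS
parafermion,
Lemma 1: half of discrete Cauchy–Riemann at σ = 5/8, x = x_c); (U) is a universality statement of
the kind proved for
percolation/Ising/FK on isoradial graphs (Grimmett–Manolescu; Chelkak–Smirnov;
Duminil-Copin–Li–Manolescu) and begun for
SAW by Glazman–Manolescu (arXiv:1708.00395: Yang–Baxter-weighted SAW on rhombic tilings of ℤ² has
the SAME boundary
two-point function and critical fugacity as the hexagonal walk).

Lean: the hexagonal SAW law is not in the library (definition request defn HexSAWLaw); the typed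
shell of X3 abstracts it
as a comparison family Q (TransferShape; with Q := hex law it IS (H) ∧ (U)):
∀ (D : Literature.Probability.RandomPlanarGeometry.DobrushinDomain) (a b : ℝ →
Literature.Probability.LatticeModels.Site 2),
Literature.Probability.RandomPlanarGeometry.SAW.IsEndpointApprox D a b → ∃ Q : ℝ →
MeasureTheory.Measure (Literature.Probability.RandomPlanarGeometry.CurveClass ℂ), (∃ Γ : (NNReal →
ℝ) → Literature.Probability.RandomPlanarGeometry.CurveClass ℂ,
Literature.Probability.RandomPlanarGeometry.IsSLECurve ((8 : NNReal) / 3) D Γ ∧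
Literature.Probability.RandomPlanarGeometry.TendstoLaw (fun (_ : ℝ) (x :
Literature.Probability.RandomPlanarGeometry.CurveClass ℂ) => x) Q Γ
Literature.Probability.Process.preWienerMeasure) ∧ (∀ f : BoundedContinuousFunction
(Literature.Probability.RandomPlanarGeometry.CurveClass ℂ) ℝ, Filter.Tendsto (fun δ => (∫ γ, f
γ.curve ∂(Literature.Probability.RandomPlanarGeometry.SAW.law D.carrier δ (a δ) (b δ))) - ∫ x, f x
∂(Q δ)) (nhdsWithin 0 (Set.Ioi 0)) (nhds 0))

Rationale: WHY THIS LINE. The conjunct is on δℤ², where "self-avoiding walk … is not believed to be integrable,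
therefore it is
not reasonable to expect … a well-behaved equivalent observable" (Glazman–Manolescu arXiv:1708.00395
p.1). The only
lattice where exact SAW identities exist is the hexagonal one (Nienhuis 1982;
DuminilCopinSmirnov2012 Lemma 1 ⇒
μ = √(2+√2); bridge/strip identities Lemma 2; Beaton–Bousquet-Mélou–de Gier–Duminil-Copin–Guttmann).
Universality
technology on isoradial graphs — the star–triangle / Yang–Baxter track-exchange — has carried
critical behaviour from
one lattice to all rhombic tilings for percolation (Grimmett–Manolescu 2013–14), Ising
(Chelkak–Smirnov 2012) and FK
(Duminil-Copin–Li–Manolescu 2018), and Glazman–Manolescu made the first SAW step (universality of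
x_c and of the
half-plane boundary 2-point function across YB-weighted tilings, hex = all angles π/3). So: prove
SLE_{8/3} where the
parafermion lives (H), and transport it (U). Area imported: integrable lattice models / Yang–Baxter
equation.
New objects (definition requests, constructions elementary): the hexagonal-lattice critical SAW law
in a Dobrushin
domain (DCS §4), and the Glazman–Manolescu YB-weighted SAW on a rhombic tiling with angle sequence
Θ.

RANKED CRUXES:
 r2 LatticeUniversality (informal until HexSAWLaw lands; hardest, most informative and the NEW
mathematics): for every
    Dobrushin domain, square-lattice endpoint approximation (a_δ, b_δ) and hexagonal one (a'_δ,
b'_δ), ∫ f∘curve dP^{ℤ²}_δ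
    − ∫ f∘curve dP^{hex}_δ → 0 for all bounded continuous f on CurveClass ℂ. Note the uniform ℤ²
walk is NOT a member of
    the GM Yang–Baxter family (their walks live on faces and may revisit a rhombus), so r2 needs a
further comparison
    "GM-weighted square tiling at θ = π/2 ~ uniform ℤ² SAW in the scaling limit" — recorded as r4.
 r3 HexConjecture (informal): DCS Conjecture 1 verbatim (hexagonal lattice, closest-vertex
endpoints).
 r4 YBtoUniform (informal): the GM YB-weighted SAW on the square tiling (all angles π/2) at its
critical point and the
    uniform ℤ² SAW at x_c(ℤ²) have the same chordal scaling limit(s) in every Dobrushin domain.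
 r5 YBUniversalityOfLimit (informal): the chordal scaling limit (all subsequential limits) of the
critical GM
    YB-weighted SAW is independent of the angle sequence Θ ∈ [π/3, 2π/3]^ℕ (extension of GM Thm
1.1-type 2-point
    universality to the curve law); with Θ ≡ π/3 = hex this links r3 to r4.
 Assembly (typed): TransferShape → SAWScalingLimit (Q → SLE law and law_δ − Q_δ → 0 on test
functions ⇒ law_δ → SLE;
    two-ε argument; measurability automatic).

KILL CRITERIA. ¬r4 or ¬r5 (a Θ-dependent or weight-dependent limit) closes this route without
touching the conjunct.
¬r2 with r3 proved would exhibit non-universality hex ≠ ℤ² — closes the route and is major evidence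
against the
conjunct's κ = 8/3 on ℤ².
NOT DECOMPOSED YET: everything inside (H) (that is Route SAWParafermion on the hexagonal lattice);
the track-exchange
coupling of curve LAWS (GM only control partition functions); endpoint conventions on Hex.
Sources: DuminilCopinSmirnov2012 (Lemma 1–2, Conj. 1), arXiv:1708.00395 (Thm 1.1–1.2, §3),
Nienhuis1982,
GrimmettManolescu2014, ChelkakSmirnov2012, arXiv:1109.0358 (BBdGDG bridges).

Novelty: NOVELTY (retriage pass, search-before-claim: lit search local+crossref/zbmath, lit search --hybrid,
lit vsearch,
lit frontier CriticalPhenomena --since 2020, lit galaxy search --star pdf; remote OpenAlex/S2/arXiv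
rate-limited today).
Nearest prior art found:
 (1) GlazmanManolescu2019 (arXiv:1708.00395) — the route's own seed: Yang–Baxter-weighted SAW on
rhombic tilings H(Θ),
     Θ ∈ [π/3,2π/3]^ℕ; Thm 1 (p.3): half-plane boundary 2-point function G_Θ(a,b) = G_{π/3}(a,b);
Thm 2: bridges
     B_{T,Θ} → 0; Thm 3/Prop 1.2: critical fugacity universal; p.11: "the Yang–Baxter transformation
… transforms the
     rhombic tiling while preserving the partition function"; p.2: "the first step towards
universality of the
     self-avoiding walk". PARTITION-FUNCTION level only; uniform ℤ² walk not in the family (p.1).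
 (2) Curve/arm-level isoradial universality where a configuration coupling exists:
GrimmettManolescu2011
     (arXiv:1108.2784) and GrimmettManolescu2014Isoradial (arXiv:1204.0505) for percolation,
ChelkakSmirnov2012Ising
     (arXiv:0910.2045) for Ising interfaces, Duminil-Copin–Li–Manolescu (arXiv:1711.02338) for FK,
DKKMO2020Rotational
     (arXiv:2012.11672: track exchange "seen as a random map on configurations", pushforward
preserves the measure,
     p.8) — none for SAW.
 (3) Hex→other-lattice transfer for SAW in print is numerical/asymptotic only:
BeatonGuttmannJensen2012
     (arXiv:1110.1141: DCS identity holds asymptotically on ℤ² with lattice-dependent constants  [refs: 1708.00395, 1108.2784, 1204.0505, 0910.2045, 1711.02338, 2012.11672, 1110.1141, 1109.3091, GlazmanManolescu2019, GrimmettManolescu2011, BeatonGuttmannJensen2012, KennedyLawler2013, DuminilCopinSmirnov2012]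

Barriers (technique_class: yang-baxter universality-transfer; curve-law comparison): BARRIERS (catalogue Literature/Barriers/CriticalPhenomena/, decls in namespace
Literature.Barriers.CriticalPhenomena):
 - Literature.Barriers.CriticalPhenomena.ParafermionicHalfCauchyRiemann (decl
ParafermionicHalfCauchyRiemann, PROVED
   _holds): APPLIES in full to crux r3 HexConjecture =
Literature.Probability.RandomPlanarGeometry.SAW.HexSAWScalingLimit (the barrier's "blocks" names
this
   route's (H)): DCS Lemma 1 gives ≈(2/3)E relations for E unknowns, every domain containing a
hexagon carries a non-zero
   kernel element with zero boundary values (not_determined_of), so vertex relations + boundary data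
cannot identify the
   observable's limit. NOT evaded: the route quarantines (H) as one undecomposed crux; the bet is
that the new content is
   (U) and that (H) falls to model-specific input beyond the vertex relations (DCS Conjecture 2
programme; sibling route
   SAWParafermion) — if (H) never closes, the route still converts the conjunct into "Hex ⇒ ℤ²".
 - Literature.Barriers.CriticalPhenomena.NienhuisWeightsExcludeVertexSAW (decl
NienhuisWeightsExcludeVertexSAW, PROVED;
   audit theorem not_hasExactVertexRelationZ2 : ¬ HasExactVertexRelationZ2): APPLIES to any attempt
to reach the uniform
   ℤ² walk through an exact local observable identity (technique class HasExactVertexRelationZ2 is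
EMPTY). EVADED BY
   DESIGN: the route writes no identity on ℤ²; integrable structure is used only on Hex / the GM
Yang–Baxter family, and
   the uniform walk enters solely through the

History (route lifecycle, newest last):
- 2026-08-15T13:48:09Z · CLOSED retired — not-a-thesis: assembly does not conclude the sub-problem Statement (operator:999:1257524)

sub-problem: SAWScalingLimit · status: closed(retired) · opened planner-plan-CriticalPhenomena-SAWScalingLimit-0 2026-08-13T19:12:12Z · rev 3 · ledger route-CriticalPhenomena-SAWHexUniversality
GENERATED by the gate from the ledger (D-0016/17). Provers cite these decls: `theorem foo : Summit.CriticalPhenomena.SAWScalingLimit.Theses.SAWHexUniversality.<Decl> := …` in Summits/CriticalPhenomena/SAWScalingLimit/Theorems/<Name>.lean.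
-/

namespace Summit.CriticalPhenomena.SAWScalingLimit.Theses.SAWHexUniversality

open scoped BigOperators Topology Manifold Classical MeasureTheory ProbabilityTheory Matrix InnerProductSpace ComplexConjugate ContinuousMap
open Filter Set Function TopologicalSpace MeasureTheory

attribute [summit_statement] _root_.SAWScalingLimit

/-- item stmt-CriticalPhenomena-0807 · crux · rank 2 · open · by planner
why it might fail: Uniform Z^2 SAW is in no Yang-Baxter/integrable family (GM2019 p.1; barrier NienhuisWeightsExcludeVertexSAW): no transfer tool reaches it; lattice effects persist in limits of boundary SAW ensembles (KennedyLawler2013); typed 'P^Z2 - P^Hex -> 0 on all test functions' needs tightness of both, open.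
sources: GlazmanManolescu2019, Thm 1 and p.1, KennedyLawler2013 (arXiv:1109.3091), pp.2,4,7, DuminilCopinSmirnov2012, p.3, Literature.Barriers.CriticalPhenomena.NienhuisWeightsExcludeVertexSAW, Literature.Barriers.CriticalPhenomena.not_hasExactVertexRelationZ2
[crux] r2 (hardest, most informative; informal until defn HexSAWLaw lands): lattice universality of
the chordal critical SAW law — for every Dobrushin domain (Ω; a, b), every square-lattice endpoint
approximation (a_δ, b_δ) (Literature.Probability.RandomPlanarGeometry.SAW.IsEndpointApprox) and
every hexagonal-lattice endpoint approximation (a'_δ, b'_δ), and every bounded continuous f on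
CurveClass ℂ: ∫ f∘curve dP^{Z^2}_{x_c(Z^2),δ} − ∫ f∘curve dP^{Hex}_{x_c(Hex),δ} → 0 as δ → 0+
(x_c(Hex) = 1/√(2+√2), Duminil-Copin–Smirnov 2012 Thm 1). Tool: Yang–Baxter track exchange on
rhombic tilings (Glazman–Manolescu arXiv:1708.00395 §3), which so far controls boundary two-point
functions, not curve laws. -/
@[route_item "route-CriticalPhenomena-SAWHexUniversality", crux]
def LatticeUniversality : Prop :=
  ∀ (D : Literature.Probability.RandomPlanarGeometry.DobrushinDomain) (a b : ℝ → Literature.Probability.LatticeModels.Site 2) (a' b' : ℝ → Literature.Probability.LatticeModels.HexVertex), Literature.Probability.RandomPlanarGeometry.SAW.IsEndpointApprox D a b → Literature.Probability.RandomPlanarGeometry.SAW.IsEmbEndpointApprox Literature.Probability.LatticeModels.hexGraph Literature.Probability.LatticeModels.hexCenter D a' b' → ∀ f : BoundedContinuousFunction (Literature.Probability.RandomPlanarGeometry.CurveClass ℂ) ℝ, Filter.Tendsto (fun δ => (∫ γ, f γ.curve ∂(Literature.Probability.RandomPlanarGeometry.SAW.law D.carrier δ (a δ) (b δ))) - ∫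 γ, f γ.curve ∂(Literature.Probability.RandomPlanarGeometry.SAW.hexSAWLaw D.carrier δ (a' δ) (b' δ))) (nhdsWithin 0 (Set.Ioi 0)) (nhds 0)

/-- item stmt-CriticalPhenomena-0808 · crux · rank 3 · open · by planner
why it might fail: = DCS2012 Conj. 1, open: the parafermion obeys only half of discrete Cauchy-Riemann (barrier ParafermionicHalfCauchyRiemann; DCS §4); no tightness/arm bounds on Hex (best: sub-ballisticity DuminilCopinHammond2013, arXiv:2310.17299); SLE(8/3) known only given a conformally covariant limit (LSW04).
sources: DuminilCopinSmirnov2012, §4 Conjectures 1-2, LawlerSchrammWerner2004SAW, §1 and Prediction 1, DuminilCopinHammond2013 (arXiv:1205.0401), arXiv:2310.17299, Literature.Barriers.CriticalPhenomena.ParafermionicHalfCauchyRiemann, Literature.Probability.RandomPlanarGeometry.SAW.HexSAWScalingLimit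
[crux] r3 (informal until defn HexSAWLaw lands): Duminil-Copin–Smirnov 2012 Conjecture 1 verbatim
(arXiv:1007.0575 p.9): let Ω ≠ ℂ be simply connected (here: a Dobrushin domain) with boundary points
a, b; Ω_δ the largest finite domain of δHex inside Ω, a_δ, b_δ the vertices of Ω_δ closest to a, b;
for x = x_c = 1/√(2+√2) the law of the SAW γ_δ in (Ω_δ, a_δ, b_δ) with weight ∝ x^{ℓ(γ)} converges
as δ → 0 to chordal SLE(8/3) in Ω from a to b
(Literature.Probability.RandomPlanarGeometry.ConvergesInLawToSLE (8/3)). -/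
@[route_item "route-CriticalPhenomena-SAWHexUniversality", crux]
def HexConjecture : Prop :=
  ∀ (D : Literature.Probability.RandomPlanarGeometry.DobrushinDomain) (a b : ℝ → Literature.Probability.LatticeModels.HexVertex), Literature.Probability.RandomPlanarGeometry.SAW.IsEmbEndpointApprox Literature.Probability.LatticeModels.hexGraph Literature.Probability.LatticeModels.hexCenter D a b → Literature.Probability.RandomPlanarGeometry.ConvergesInLawToSLE ((8 : NNReal) / 3) D (fun δ (γ : Literature.Probability.RandomPlanarGeometry.SAW.HexDomainSAW D.carrier δ (a δ) (b δ)) => γ.curve) (fun δ => Literature.Probability.RandomPlanarGeometry.SAW.hexSAWLaw D.carrier δ (a δ) (b δ))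

/-- item stmt-CriticalPhenomena-0809 · crux · rank 4 · closed · moot by None · by planner
why it might fail: GM's theta=pi/2 walk is another microscopic model (self-touching, w1=w2>0, v<u1; growth 2.448 vs mu(Z2)~2.638, Glazman2015 p.3): equal chordal limits with the UNIFORM walk is the universality hypothesis itself - no coupling, no FKG for SAW, no observable on Z^2 (not_hasExactVertexRelationZ2).
sources: Glazman2015WeightedSAW, Thm 1.1 and p.3, GlazmanManolescu2019, eq. (1) and pp.1-2, DuminilCopin2013Parafermion, Remark 12.13, Literature.Barriers.CriticalPhenomena.NienhuisWeightsExcludeVertexSAW, Literature.Barriers.CriticalPhenomena.not_hasExactVertexRelationZ2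
[crux] r4 (informal until defn YangBaxterSAW lands): in every Dobrushin domain, the
Glazman–Manolescu Yang–Baxter-weighted self-avoiding walk on the square rhombic tiling (all angles θ
= π/2; walk on faces, weights 1, u1, u2, v, w1, w2 of arXiv:1708.00395 Fig. 1 at θ = π/2, critical
fugacity of GM Thm 1.1) between boundary points a_δ, b_δ and the uniform square-lattice SAW law
Literature.Probability.RandomPlanarGeometry.SAW.law at x_c(Z^2) have asymptotically equal laws on
CurveClass ℂ (difference of bounded-continuous test integrals → 0). This is the genuinely new
comparison: the uniform Z^2 walk is not in the YB family. -/
@[route_item "route-CriticalPhenomena-SAWHexUniversality"]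
def YBtoUniform : Prop :=
  ∀ (D : Literature.Probability.RandomPlanarGeometry.DobrushinDomain) (a b : ℝ → Literature.Probability.LatticeModels.Site 2), Literature.Probability.RandomPlanarGeometry.SAW.IsEndpointApprox D a b → let cornerZ : (ℤ → ℝ) → Literature.Probability.RandomPlanarGeometry.SAW.YangBaxter.Face → ℂ := fun Ψ f => (f.2 : ℂ) * Complex.I - Complex.I / 2 + (if 0 ≤ f.1 then ∑ i ∈ Finset.range f.1.toNat, Literature.Probability.RandomPlanarGeometry.SAW.YangBaxter.colShift Ψ i else -∑ i ∈ Finset.range (-f.1).toNat, Literature.Probability.RandomPlanarGeometry.SAW.YangBaxter.colShift Ψ (-((i : ℤ) + 1))); let midZ : (ℤ → ℝ) → Literature.Probability.RandomPlanarGeometry.SAW.YangBaxter.MidEdge → ℂ := fun Ψ e => match e with | .vert k j => cornerZ Ψ (k, j) + Complex.I / 2 | .slant k j => cornerZ Ψ (k, j) + Literature.Probability.RandomPlanarGeometry.SAW.YangBaxter.colShift Ψ k / 2; let dom : (ℤ → ℝ) → ℝ → Set Literature.Probability.RandomPlanarGeometry.SAW.YangBaxter.Face := fun Ψ δ => {f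 | ∀ s : Literature.Probability.RandomPlanarGeometry.SAW.YangBaxter.Side, (δ : ℂ) * midZ Ψ (Literature.Probability.RandomPlanarGeometry.SAW.YangBaxter.Face.side f s) ∈ D.carrier}; let crv : (ℤ → ℝ) → ℝ → List Literature.Probability.RandomPlanarGeometry.SAW.YangBaxter.MidEdge → Literature.Probability.RandomPlanarGeometry.CurveClass ℂ := fun Ψ δ l => Literature.Probability.RandomPlanarGeometry.CurveClass.mk ⟨Literature.Probability.LatticeModels.polyline (l.map fun e => (δ : ℂ) * midZ Ψ e)⟩; let Q : (ℤ → ℝ) → (ℝ → Literature.Probability.RandomPlanarGeometry.SAW.YangBaxter.MidEdge) → (ℝ → Literature.Probability.RandomPlanarGeometry.SAW.YangBaxter.MidEdge) → ℝ → MeasureTheory.Measure (Literature.Probability.RandomPlanarGeometry.CurveClass ℂ) := fun Ψ a b δ => (Literature.Probability.RandomPlanarGeometry.SAW.YangBaxter.twoPoint (dom Ψ δ) Ψ (a δ) (b δ))⁻¹ • MeasureTheory.Measure.sum (fun γ : Literature.Probability.RandomPlanarGeometry.SAW.YangBaxter.YBWalk (dom Ψ δ) (a δ) (b δ) => ENNReal.ofReal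 (γ.weight Ψ) • MeasureTheory.Measure.dirac (crv Ψ δ γ.mids)); let EA : (ℤ → ℝ) → (ℝ → Literature.Probability.RandomPlanarGeometry.SAW.YangBaxter.MidEdge) → (ℝ → Literature.Probability.RandomPlanarGeometry.SAW.YangBaxter.MidEdge) → Prop := fun Ψ a b => (∀ᶠ δ in nhdsWithin 0 (Set.Ioi 0), Nonempty (Literature.Probability.RandomPlanarGeometry.SAW.YangBaxter.YBWalk (dom Ψ δ) (a δ) (b δ))) ∧ Filter.Tendsto (fun δ : ℝ => (δ : ℂ) * midZ Ψ (a δ)) (nhdsWithin 0 (Set.Ioi 0)) (nhds (D.pt 0)) ∧ Filter.Tendsto (fun δ : ℝ => (δ : ℂ) * midZ Ψ (b δ)) (nhdsWithin 0 (Set.Ioi 0)) (nhds (D.pt 1)); ∀ (a' b' : ℝ → Literature.Probability.RandomPlanarGeometry.SAW.YangBaxter.MidEdge), EA (fun _ => Real.pi / 2) a' b' → ∀ f : BoundedContinuousFunction (Literature.Probability.RandomPlanarGeometry.CurveClass ℂ) ℝ, Filter.Tendsto (fun δ => (∫ γ, f γ.curve ∂(Literature.Probability.RandomPlanarGeometry.SAW.law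 D.carrier δ (a δ) (b δ))) - ∫ x, f x ∂(Q (fun _ => Real.pi / 2) a' b' δ)) (nhdsWithin 0 (Set.Ioi 0)) (nhds 0)

/-- item stmt-CriticalPhenomena-0810 · crux · rank 5 · closed · moot by None · by planner
why it might fail: GM's Yang-Baxter move preserves partition functions only (GM2019 p.11, Cor. 3.2), not walks; for percolation/FK track exchange is a measure-preserving map on configurations tamed by FKG/RSW (DKKMO2020 pp.8-10; GrimmettManolescu2014Isoradial) - SAW has no such coupling; typed form needs tightness.
sources: GlazmanManolescu2019, Thm 1, §3 Prop. 3.1/Cor. 3.2, p.11, DKKMO2020Rotational (arXiv:2012.11672), pp.8-10, GrimmettManolescu2014Isoradial (arXiv:1204.0505), arXiv:1711.02338 (Duminil-Copin-Li-Manolescu, FK on isoradial graphs), ChelkakSmirnov2012Ising (arXiv:0910.2045), Literature.Probability.RandomPlanarGeometry.SAW.YangBaxter.GlazmanManolescu2019_thm1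
[crux] r5 (informal): for the critical Glazman–Manolescu YB-weighted SAW on the rhombic tiling H(Θ),
Θ ∈ [π/3, 2π/3]^ℕ, in a Dobrushin domain, the set of subsequential weak limits (δ → 0+) of the
chordal law on CurveClass ℂ does not depend on Θ (curve-law upgrade of the two-point universality
arXiv:1708.00395 Thm 1.1/1.2). With Θ ≡ π/3 (hexagonal lattice) and Θ ≡ π/2 this links HexConjecture
(r3) to YBtoUniform (r4) and yields LatticeUniversality (r2). -/
@[route_item "route-CriticalPhenomena-SAWHexUniversality"]
def YBUniversalityOfLimit : Prop :=
  ∀ (D : Literature.Probability.RandomPlanarGeometry.DobrushinDomain) (Θ Θ' : ℤ → ℝ), (∀ k, Θ k ∈ Set.Icc (Real.pi / 3) (2 * Real.pi / 3)) → (∀ k, Θ' k ∈ Set.Icc (Real.pi / 3) (2 * Real.pi / 3)) → let cornerZ : (ℤ → ℝ) → Literature.Probability.RandomPlanarGeometry.SAW.YangBaxter.Face → ℂ := fun Ψ f => (f.2 : ℂ) * Complex.I - Complex.I / 2 + (if 0 ≤ f.1 then ∑ i ∈ Finset.range f.1.toNat, Literature.Probability.RandomPlanarGeometry.SAW.YangBaxter.colShift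 Ψ i else -∑ i ∈ Finset.range (-f.1).toNat, Literature.Probability.RandomPlanarGeometry.SAW.YangBaxter.colShift Ψ (-((i : ℤ) + 1))); let midZ : (ℤ → ℝ) → Literature.Probability.RandomPlanarGeometry.SAW.YangBaxter.MidEdge → ℂ := fun Ψ e => match e with | .vert k j => cornerZ Ψ (k, j) + Complex.I / 2 | .slant k j => cornerZ Ψ (k, j) + Literature.Probability.RandomPlanarGeometry.SAW.YangBaxter.colShift Ψ k / 2; let dom : (ℤ → ℝ) → ℝ → Set Literature.Probability.RandomPlanarGeometry.SAW.YangBaxter.Face := fun Ψ δ => {f | ∀ s : Literature.Probability.RandomPlanarGeometry.SAW.YangBaxter.Side, (δ : ℂ) * midZ Ψ (Literature.Probability.RandomPlanarGeometry.SAW.YangBaxter.Face.side f s) ∈ D.carrier}; let crv : (ℤ → ℝ) → ℝ → List Literature.Probability.RandomPlanarGeometry.SAW.YangBaxter.MidEdge → Literature.Probability.RandomPlanarGeometry.CurveClass ℂ := fun Ψ δ l => Literature.Probability.RandomPlanarGeometry.CurveClass.mk ⟨Literature.Probability.LatticeModels.polyline (l.map fun e => (δ : ℂ) * midZ Ψ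 e)⟩; let Q : (ℤ → ℝ) → (ℝ → Literature.Probability.RandomPlanarGeometry.SAW.YangBaxter.MidEdge) → (ℝ → Literature.Probability.RandomPlanarGeometry.SAW.YangBaxter.MidEdge) → ℝ → MeasureTheory.Measure (Literature.Probability.RandomPlanarGeometry.CurveClass ℂ) := fun Ψ a b δ => (Literature.Probability.RandomPlanarGeometry.SAW.YangBaxter.twoPoint (dom Ψ δ) Ψ (a δ) (b δ))⁻¹ • MeasureTheory.Measure.sum (fun γ : Literature.Probability.RandomPlanarGeometry.SAW.YangBaxter.YBWalk (dom Ψ δ) (a δ) (b δ) => ENNReal.ofReal (γ.weight Ψ) • MeasureTheory.Measure.dirac (crv Ψ δ γ.mids)); let EA : (ℤ → ℝ) → (ℝ → Literature.Probability.RandomPlanarGeometry.SAW.YangBaxter.MidEdge) → (ℝ → Literature.Probability.RandomPlanarGeometry.SAW.YangBaxter.MidEdge) → Prop := fun Ψ a b => (∀ᶠ δ in nhdsWithin 0 (Set.Ioi 0), Nonempty (Literature.Probability.RandomPlanarGeometry.SAW.YangBaxter.YBWalk (dom Ψ δ) (a δ) (b δ))) ∧ Filter.Tendsto (fun δ : ℝ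 => (δ : ℂ) * midZ Ψ (a δ)) (nhdsWithin 0 (Set.Ioi 0)) (nhds (D.pt 0)) ∧ Filter.Tendsto (fun δ : ℝ => (δ : ℂ) * midZ Ψ (b δ)) (nhdsWithin 0 (Set.Ioi 0)) (nhds (D.pt 1)); ∀ (a b a' b' : ℝ → Literature.Probability.RandomPlanarGeometry.SAW.YangBaxter.MidEdge), EA Θ a b → EA Θ' a' b' → ∀ f : BoundedContinuousFunction (Literature.Probability.RandomPlanarGeometry.CurveClass ℂ) ℝ, Filter.Tendsto (fun δ => (∫ x, f x ∂(Q Θ a b δ)) - ∫ x, f x ∂(Q Θ' a' b' δ)) (nhdsWithin 0 (Set.Ioi 0)) (nhds 0)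

/-- item stmt-CriticalPhenomena-0802 · support · rank 9 · closed · moot by None · by planner
[support] typed shell of X3 = (H) ∧ (U): for every Dobrushin domain and ℤ² endpoint approximation
there is a comparison family Q : ℝ → Measure (CurveClass ℂ) (INTENDED: the hexagonal critical SAW
laws in the same domain, defn HexSAWLaw) which converges in law to a chordal SLE_{8/3} curve Γ (this
is (H)) and whose test integrals differ from those of the ℤ² SAW law by o(1) as δ → 0+ (this is
(U)). As typed (∃ Q) it is implied by the conjunct (take Q = SLE law), so it carries no difficulty
by itself; it fixes the shape the informal cruxes r2–r5 must instantiate. -/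
@[route_item "route-CriticalPhenomena-SAWHexUniversality"]
def TransferShape : Prop :=
  ∀ (D : Literature.Probability.RandomPlanarGeometry.DobrushinDomain) (a b : ℝ → Literature.Probability.LatticeModels.Site 2), Literature.Probability.RandomPlanarGeometry.SAW.IsEndpointApprox D a b → ∃ Q : ℝ → MeasureTheory.Measure (Literature.Probability.RandomPlanarGeometry.CurveClass ℂ), (∃ Γ : (NNReal → ℝ) → Literature.Probability.RandomPlanarGeometry.CurveClass ℂ, Literature.Probability.RandomPlanarGeometry.IsSLECurve ((8 : NNReal) / 3) D Γ ∧ Literature.Probability.RandomPlanarGeometry.TendstoLaw (fun (_ : ℝ) (x : Literature.Probability.RandomPlanarGeometry.CurveClass ℂ) => x) Q Γ Literature.Probability.Process.preWienerMeasure) ∧ (∀ f : BoundedContinuousFunction (Literature.Probability.RandomPlanarGeometry.CurveClass ℂ) ℝ, Filter.Tendsto (fun δ => (∫ γ, f γ.curve ∂(Literature.Probability.RandomPlanarGeometry.SAW.law D.carrier δ (a δ) (b δ))) - ∫ x, f x ∂(Q δ)) (nhdsWithin 0 (Set.Ioi 0)) (nhds 0))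

/-- item stmt-CriticalPhenomena-0803 · assembly · rank 1 · closed · moot by None · by planner
[assembly] TransferShape → SAWScalingLimit: given Γ SLE_{8/3} with TendstoLaw id Q Γ
preWienerMeasure and ∫ f∘curve d law_δ − ∫ f dQ_δ → 0, conclude TendstoLaw curve law Γ
preWienerMeasure (add the two limits), AEMeasurable automatic
(Literature.Probability.RandomPlanarGeometry.SAW.aemeasurable_curve), hence ConvergesInLawToSLE
(8/3). -/
@[route_item "route-CriticalPhenomena-SAWHexUniversality"]
def Assembly : Prop :=
  (∀ (D : Literature.Probability.RandomPlanarGeometry.DobrushinDomain) (a b : ℝ → Literature.Probability.LatticeModels.Site 2), Literature.Probability.RandomPlanarGeometry.SAW.IsEndpointApprox D a b → ∃ Q : ℝ → MeasureTheory.Measure (Literature.Probability.RandomPlanarGeometry.CurveClass ℂ), (∃ Γ : (NNReal → ℝ) → Literature.Probability.RandomPlanarGeometry.CurveClass ℂ, Literature.Probability.RandomPlanarGeometry.IsSLECurve ((8 : NNReal) / 3) D Γ ∧ Literature.Probability.RandomPlanarGeometry.TendstoLaw (fun (_ : ℝ) (x : Literature.Probability.RandomPlanarGeometry.CurveClass ℂ)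 => x) Q Γ Literature.Probability.Process.preWienerMeasure) ∧ (∀ f : BoundedContinuousFunction (Literature.Probability.RandomPlanarGeometry.CurveClass ℂ) ℝ, Filter.Tendsto (fun δ => (∫ γ, f γ.curve ∂(Literature.Probability.RandomPlanarGeometry.SAW.law D.carrier δ (a δ) (b δ))) - ∫ x, f x ∂(Q δ)) (nhdsWithin 0 (Set.Ioi 0)) (nhds 0))) → Literature.Probability.RandomPlanarGeometry.SAW.SAWScalingLimit

end Summit.CriticalPhenomena.SAWScalingLimit.Theses.SAWHexUniversality
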